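import Summits.BirchSwinnertonDyer.Rank1Residual.X2.RankOne
import Summits.BirchSwinnertonDyer.Rank1Residual.X2.HigherWeightEisensteinTransfer
import Summits.BirchSwinnertonDyer.Rank1Residual.AdditivePotMult.QuadraticTwistTamagawaMultiplicative
import Literature.NumberTheory.EllipticCurves.PAdicBSDSplitMultiplicativeProofs
import Literature.NumberTheory.EllipticCurves.HeegnerHypothesisKroneckerProofs
import HarnessLib

/-!
# Class X2, rank `1`, NON-SPLIT `p ‖ N`: the CGLS partner keeps the split type, and O9 ∩ {non-split}
# is closed SCHNEIDER-FREE by the display plus Mazur's main conjecture on X2b ∩ {non-split} alone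
# (cell `bsd-eis`, seat `bsd-eis-cgshw`; memo `run/shared/lean/pub/bsd-eis/cgshw-MEMO-1.md` §2)

HONEST FRAMING (cell `bsd-eis`): theorems only (no definition, no named fact, no `sorry`); nothing
booked; X2 stays CONSTRUCTION-SHAPED; every theorem is CONDITIONAL on the typed display
`X2.RankOneDisplay` (not in print at `p ‖ N`) and on the rank-zero input it names.

`X2/RankOne.lean` proves `targetC_of_rankOneDisplay_of_targetB`: the display + `BSD(·,p)` on ALL of
sub-cell X2b (rank `0`, `¬GVPar`) give sub-cell X2c. The seat memo (§1–§2) observes that the reach of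
"[CGS] extended to higher weight" (Keller–Yin p. 4) is the NON-SPLIT primes only (tree theorems
`X2.TateLineDecomposition.not_fix_and_not_quot_of_not_split` / `fix_or_quot_of_split`: `φ|_{G_p} ≠ 1, ω`
iff non-split), and that its kernel output is `X2.MazurMainConjectureAt` on X2 ∩ {non-split}
(companion file `X2/HigherWeightEisensteinTransfer.lean`, `mazurMainConjectureAt_of_higherWeightCongruences_of_not_split`).
This file supplies the matching rank-one bookkeeping:

* `hasSplitMultiplicativeReductionAtPrime_iff_of_smul_eq_quadraticTwist` — for an admissible CGLS
  field `K` (`p` split in `K`) the twist `E^K` is split multiplicative at `p` iff `E` is: `p` split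
  ⇒ `(d_K/p) = 1` ⇒ `d_K` is a square mod `p` ⇒ the unit twist preserves the split type (tree:
  `AdditivePotMult.hasMultiplicativeReductionAt_and_split_iff_quadraticTwist_of_not_dvd`, Silverman X.2
  Ex. 10.16 / VII.5.1(b)).
* `targetC_nonsplit_of_rankOneDisplay_of_bsdp_cellB_nonsplit` — the display + `BSD(·,p)` on
  X2b ∩ {NON-SPLIT} ⟹ `BSD(E,p)` on every NON-SPLIT X2c pair (both parities; the `GVPar`-partner case is
  the closed sub-cell X2a, `targetA_of_published`).
* `targetC_nonsplit_of_rankOneDisplay_of_mazurMainConjectureAt_nonsplit` — the same with the X2b input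
  in main-conjecture currency (`bsdp_of_mazurMainConjectureAt_of_analyticRank_eq_zero`): so O9 ∩
  {non-split} ⇐ `RankOneDisplay` + `MazurMainConjectureAt` on X2b ∩ {non-split} — NO Schneider
  certificate, NO exceptional leading term (those enter only the cyclotomic closers of
  `X2/ClassClosureO9.lean`). The second input is exactly what the higher-weight transfer delivers.

References: Castella–Grossi–Lee–Skinner 2022 Thm. 5.3.1 [CastellaEtAl2021]; Keller–Yin 2024 p. 4, §5
[KellerYin2024]; Silverman AEC VII.5.1(b), X.2 [SilvermanAEC2009]; Greenberg–Vatsal 2000 §2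
[GreenbergVatsal2000].
-/

set_option autoImplicit false

noncomputable section

open scoped Classical MatrixGroups ModularForm

open CongruenceSubgroup WeierstrassCurve Literature.NumberTheory.EllipticCurves
  Literature.NumberTheory.EllipticCurves.ModularForms Literature.NumberTheory.QuadraticFields
  Literature.NumberTheory.EllipticCurves.Rank1Residual
  Literature.NumberTheory.EllipticCurves.Rank1Residual.Typed
  Literature.NumberTheory.EllipticCurves.GreenbergVatsal2000
  Literature.NumberTheory.EllipticCurves.Wuthrich2014
  Literature.NumberTheory.EllipticCurves.SteinWuthrich2013
  IsDedekindDomain NumberField Rat.HeightOneSpectrum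

namespace Summit.BirchSwinnertonDyer.Rank1Residual.X2

/-! ### The admissible twist keeps the split type -/

/-- **Split type is preserved by the CGLS twist.** For `W/ℚ` globally minimal elliptic with
multiplicative reduction at the odd prime `p`, `K` imaginary quadratic with `p` SPLIT in `K`, and a
globally minimal model `W'` of `E^{(d_K)}` (`C • W' = W.quadraticTwist d_K`): `W'` is split
multiplicative at `p` iff `W` is. Proof: `p` split and odd gives `(d_K/p) = 1` (decomposition law,
`satisfiesHeegnerHypothesis_iff_kronecker`), so `d_K` is a nonzero square mod `p`
(`legendreSym.eq_one_iff`); at the place `v` over `p` the unit twist by `d_K` is split iff `W` is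
(`AdditivePotMult.hasMultiplicativeReductionAt_and_split_iff_quadraticTwist_of_not_dvd`); split type is
an isomorphism invariant and agrees with the `AtPrime` predicate.
[cite: SilvermanAEC2009, VII.5 Prop. 5.1(b) and X.5 Cor. 5.4] -/
theorem hasSplitMultiplicativeReductionAtPrime_iff_of_smul_eq_quadraticTwist
    (W W' : WeierstrassCurve ℚ) [W.IsElliptic] [W.IsGloballyMinimal] [W'.IsElliptic]
    [W'.IsGloballyMinimal] {K : Type} [Field K] [NumberField K] (hK : IsImaginaryQuadratic K)
    (p : ℕ) [Fact p.Prime] (hp2 : p ≠ 2) (hmult : W.HasMultiplicativeReductionAtPrime p)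
    (hsplitK : SatisfiesHeegnerHypothesis p K) {C : VariableChange ℚ}
    (hC : C • W' = W.quadraticTwist (NumberField.discr K : ℚ)) :
    W'.HasSplitMultiplicativeReductionAtPrime p ↔ W.HasSplitMultiplicativeReductionAtPrime p := by
  have hpP : p.Prime := Fact.out
  have hpd : ¬ (p : ℤ) ∣ NumberField.discr K := not_dvd_discr_of_split hK hpP hp2 hsplitK
  have hj : jacobiSym (NumberField.discr K) p = 1 :=
    ((satisfiesHeegnerHypothesis_iff_kronecker p K hK.1).mp hsplitK p hpP dvd_rfl).2 hp2
  have hsq : IsSquare ((NumberField.discr K : ℤ) : ZMod p) := by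
    haveI : NeZero p := ⟨hpP.ne_zero⟩
    have h0 : ((NumberField.discr K : ℤ) : ZMod p) ≠ 0 := by
      rwa [Ne, ZMod.intCast_zmod_eq_zero_iff_dvd]
    rw [← legendreSym.eq_one_iff p h0, jacobiSym.legendreSym.to_jacobiSym]
    exact hj
  obtain ⟨v, rfl⟩ : ∃ v : HeightOneSpectrum (𝓞 ℚ), ((primesEquiv v : ℕ)) = p :=
    ⟨primesEquiv.symm ⟨p, Fact.out⟩, by rw [Equiv.apply_symm_apply]⟩
  have hWv : W.HasMultiplicativeReductionAt v :=
    (W.hasMultiplicativeReductionAtPrime_iff_hasMultiplicativeReductionAt_ringOfIntegers v).mp hmult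
  obtain ⟨-, -, hkey⟩ :=
    AdditivePotMult.hasMultiplicativeReductionAt_and_split_iff_quadraticTwist_of_not_dvd W v hp2 hpd hWv
  have hW' : W'.HasSplitMultiplicativeReductionAt v ↔
      (W.quadraticTwist (NumberField.discr K : ℚ)).HasSplitMultiplicativeReductionAt v := by
    rw [← hC]
    exact (hasSplitMultiplicativeReductionAt_smul_iff_holds v W' C).symm
  rw [W'.hasSplitMultiplicativeReductionAtPrime_iff_hasSplitMultiplicativeReductionAt v,
    W.hasSplitMultiplicativeReductionAtPrime_iff_hasSplitMultiplicativeReductionAt v, hW', hkey]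
  exact iff_true_left hsq

/-- The NON-SPLIT form used below: if `E` is non-split multiplicative at `p` (odd, split in `K`), so is
every globally minimal model of the CGLS twist `E^K`. [cite: SilvermanAEC2009, VII.5 Prop. 5.1(b) and X.5 Cor. 5.4] -/
theorem not_hasSplitMultiplicativeReductionAtPrime_of_smul_eq_quadraticTwist
    (W W' : WeierstrassCurve ℚ) [W.IsElliptic] [W.IsGloballyMinimal] [W'.IsElliptic]
    [W'.IsGloballyMinimal] {K : Type} [Field K] [NumberField K] (hK : IsImaginaryQuadratic K)
    (p : ℕ) [Fact p.Prime] (hp2 : p ≠ 2) (hmult : W.HasMultiplicativeReductionAtPrime p)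
    (hns : ¬ W.HasSplitMultiplicativeReductionAtPrime p) (hsplitK : SatisfiesHeegnerHypothesis p K)
    {C : VariableChange ℚ} (hC : C • W' = W.quadraticTwist (NumberField.discr K : ℚ)) :
    ¬ W'.HasSplitMultiplicativeReductionAtPrime p := fun h ↦
  hns ((hasSplitMultiplicativeReductionAtPrime_iff_of_smul_eq_quadraticTwist W W' hK p hp2 hmult
    hsplitK hC).mp h)

/-! ### O9 ∩ {non-split} from the display and the NON-SPLIT half of X2b -/

/-- **X2c ∩ {non-split} ⇐ display + `BSD(·,p)` on X2b ∩ {non-split}** (refinement of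
`targetC_of_rankOneDisplay_of_targetB`): for a rank-one X2 pair at a NON-SPLIT `p`, the CGLS partner
`E^K` is a rank-`0` X2 pair (`classX2_twist`) which is again NON-SPLIT
(`not_hasSplitMultiplicativeReductionAtPrime_of_smul_eq_quadraticTwist`); if it has the GV parity it lies
in the CLOSED sub-cell X2a (`targetA_of_published`), otherwise in X2b ∩ {non-split}, where `hBns` is
the input. Then `bsdp_of_cellC_of_rankOneDisplay`. CONDITIONAL on `RankOneDisplay` and `hBns`.
[cite: CastellaEtAl2021, Thm. 5.3.1 and (5.5)–(5.7)] [cite: GreenbergVatsal2000, Thm. (1.3) with pp. 1, 14–15] -/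
theorem targetC_nonsplit_of_rankOneDisplay_of_bsdp_cellB_nonsplit
    (hGV : lambdaMu_multiplicative_of_gvPar) (hWu : thm16_charIdeal_dvd_multiplicative_of_reducible)
    (hJs : thm61_splitMultiplicative) (hJn : thm61_nonsplitMultiplicative)
    (hHs : exists_isSplitMultCanonical) (hHn : exists_isMultCanonical)
    (hGZK : rank_eq_analyticRank_of_analyticRank_le_one) (hpar : nonempty_modularParametrizationData)
    (hGS : ∀ (W : WeierstrassCurve ℚ) [W.IsElliptic] [W.IsGloballyMinimal] (p : ℕ) [Fact p.Prime],
      greenberg_stevens (W := W) (p := p))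
    (hmod : exists_isNewformOf) (hHL : HoffsteinLuo1997_exists_twist_L_one_ne_zero)
    (hGZ : GrossZagier1986_thm_I_7_3) (hdisp : RankOneDisplay)
    (hBns : ∀ (W : WeierstrassCurve ℚ) [W.IsElliptic] [W.IsGloballyMinimal] (p : ℕ) [Fact p.Prime],
      CellB W p → ¬ W.HasSplitMultiplicativeReductionAtPrime p → BSDp W p)
    (W : WeierstrassCurve ℚ) [W.IsElliptic] [W.IsGloballyMinimal] (p : ℕ) [Fact p.Prime]
    (hc : CellC W p) (hns : ¬ W.HasSplitMultiplicativeReductionAtPrime p) : BSDp W p := by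
  have hmod' := WeierstrassCurve.hasEntireLFunction_rat_of_exists_isNewformOf hmod
  have h0 : ∀ (W' : WeierstrassCurve ℚ) [W'.IsElliptic] [W'.IsGloballyMinimal],
      ClassX2 W' p → W'.analyticRank = 0 → ¬ W'.HasSplitMultiplicativeReductionAtPrime p →
        BSDp W' p := by
    intro W' _ _ hX' hr' hns'
    by_cases hgv : GVPar W' p
    · exact targetA_of_published hGV hWu hJs hJn hHs hHn hGZK hmod' hpar hGS W' p ⟨hr', hX', hgv⟩
    · exact hBns W' p ⟨hr', hX', hgv⟩ hns'
  refine bsdp_of_cellC_of_rankOneDisplay hmod hHL hGZ hGZK hdisp W p hc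
    (fun K _ _ hK _ _ _ hsplit _ Wd _ _ hWd hrd ↦ ?_)
  obtain ⟨C, hC⟩ := hWd
  have hnsd : ¬ Wd.HasSplitMultiplicativeReductionAtPrime p :=
    not_hasSplitMultiplicativeReductionAtPrime_of_smul_eq_quadraticTwist W Wd hK p hc.2.1 hc.2.2.2 hns
      hsplit hC
  exact pPartRankZero_of_pPart hGZK Wd p hrd
    (pPart_of_bsdp hmod' hGZK Wd p (by omega)
      (h0 Wd (classX2_twist W p hc.2 K hK hsplit Wd ⟨C, hC⟩) hrd hnsd))

/-- **O9 ∩ {non-split}, SCHNEIDER-FREE: display + Mazur's main conjecture on X2b ∩ {non-split}.** For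
every rank-one X2 pair at a NON-SPLIT `p`: `BSD(E,p)` from the PUBLISHED facts, the typed display
`X2.RankOneDisplay`, and `X2.MazurMainConjectureAt` at every rank-`0`, `¬GVPar`, NON-SPLIT X2 pair
(`hMCns`; fed to `bsdp_of_mazurMainConjectureAt_of_analyticRank_eq_zero`). `hMCns` is exactly the output
of the higher-weight transfer at non-split primes (companion file
`X2/HigherWeightEisensteinTransfer.lean`, `mazurMainConjectureAt_of_higherWeightCongruences_of_not_split`;
Keller–Yin p. 4: "provided the results in [CGS] are extended to higher weight modular forms"). Unlike
the cyclotomic closers of `X2/ClassClosureO9.lean` this road needs NO Schneider certificate and NO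
exceptional leading term. CONDITIONAL. [cite: KellerYin2024, p. 4 (remark after Thm. 4) and §5]
[cite: CastellaEtAl2021, Thm. 5.3.1] -/
theorem targetC_nonsplit_of_rankOneDisplay_of_mazurMainConjectureAt_nonsplit
    (hGV : lambdaMu_multiplicative_of_gvPar) (hWu : thm16_charIdeal_dvd_multiplicative_of_reducible)
    (hJs : thm61_splitMultiplicative) (hJn : thm61_nonsplitMultiplicative)
    (hHs : exists_isSplitMultCanonical) (hHn : exists_isMultCanonical)
    (hGZK : rank_eq_analyticRank_of_analyticRank_le_one) (hpar : nonempty_modularParametrizationData)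
    (hGS : ∀ (W : WeierstrassCurve ℚ) [W.IsElliptic] [W.IsGloballyMinimal] (p : ℕ) [Fact p.Prime],
      greenberg_stevens (W := W) (p := p))
    (hmod : exists_isNewformOf) (hHL : HoffsteinLuo1997_exists_twist_L_one_ne_zero)
    (hGZ : GrossZagier1986_thm_I_7_3) (hdisp : RankOneDisplay)
    (hMCns : ∀ (W : WeierstrassCurve ℚ) [W.IsElliptic] [W.IsGloballyMinimal] (p : ℕ) [Fact p.Prime],
      CellB W p → ¬ W.HasSplitMultiplicativeReductionAtPrime p → MazurMainConjectureAt W p)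
    (W : WeierstrassCurve ℚ) [W.IsElliptic] [W.IsGloballyMinimal] (p : ℕ) [Fact p.Prime]
    (hc : CellC W p) (hns : ¬ W.HasSplitMultiplicativeReductionAtPrime p) : BSDp W p :=
  targetC_nonsplit_of_rankOneDisplay_of_bsdp_cellB_nonsplit hGV hWu hJs hJn hHs hHn hGZK hpar hGS hmod
    hHL hGZ hdisp
    (fun W' _ _ p' _ hB hns' ↦
      bsdp_of_mazurMainConjectureAt_of_analyticRank_eq_zero hJs hJn hHs hHn hGZK
        (WeierstrassCurve.hasEntireLFunction_rat_of_exists_isNewformOf hmod) hpar W' p' (hGS W' p')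
        hB.2.1.1 hB.2.1.2.2 hB.1 (hMCns W' p' hB hns'))
    W p hc hns

/-! ### X2 ∩ {non-split} as a whole: two typed inputs -/

/-- **Class X2 at a NON-SPLIT prime, every analytic rank `≤ 1`, both parities: `BSD(E,p)` from the
PUBLISHED facts and TWO typed inputs** — the display `X2.RankOneDisplay` and the higher-weight
congruence input `HigherWeightCongruencesAt` on X2b ∩ {non-split} (`X2/HigherWeightEisensteinTransfer.lean`,
"the results in [CGS] extended to higher weight modular forms", Keller–Yin p. 4): sub-cell X2a by
`targetA_of_published`; X2b ∩ {non-split} by `bsdp_of_higherWeightCongruences_of_analyticRank_eq_zero_of_not_split`;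
X2c ∩ {non-split} by `targetC_nonsplit_of_rankOneDisplay_of_mazurMainConjectureAt_nonsplit` fed with
`mazurMainConjectureAt_of_higherWeightCongruences_of_not_split`. No Schneider certificate, no exceptional
leading term. CONDITIONAL on the two typed inputs (neither in print). [cite: KellerYin2024, p. 4 (remark after Thm. 4) and §5]
[cite: CastellaEtAl2021, Thm. 5.3.1] -/
theorem bsdp_of_classX2_of_not_split_of_rankOneDisplay_of_higherWeightCongruences
    (hGV : lambdaMu_multiplicative_of_gvPar) (hWu : thm16_charIdeal_dvd_multiplicative_of_reducible)
    (hJs : thm61_splitMultiplicative) (hJn : thm61_nonsplitMultiplicative)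
    (hHs : exists_isSplitMultCanonical) (hHn : exists_isMultCanonical)
    (hGZK : rank_eq_analyticRank_of_analyticRank_le_one) (hpar : nonempty_modularParametrizationData)
    (hGS : ∀ (W : WeierstrassCurve ℚ) [W.IsElliptic] [W.IsGloballyMinimal] (p : ℕ) [Fact p.Prime],
      greenberg_stevens (W := W) (p := p))
    (hmod : exists_isNewformOf) (hHL : HoffsteinLuo1997_exists_twist_L_one_ne_zero)
    (hGZ : GrossZagier1986_thm_I_7_3) (hdisp : RankOneDisplay)
    (hK : ∀ (W : WeierstrassCurve ℚ) [W.IsElliptic] [W.IsGloballyMinimal] (p : ℕ) [Fact p.Prime],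
      CellB W p → ¬ W.HasSplitMultiplicativeReductionAtPrime p → HigherWeightCongruencesAt W p)
    (W : WeierstrassCurve ℚ) [W.IsElliptic] [W.IsGloballyMinimal] (p : ℕ) [Fact p.Prime]
    (hr : W.analyticRank ≤ 1) (hX : ClassX2 W p) (hns : ¬ W.HasSplitMultiplicativeReductionAtPrime p) :
    BSDp W p := by
  have hmod' := WeierstrassCurve.hasEntireLFunction_rat_of_exists_isNewformOf hmod
  have hMCns : ∀ (W' : WeierstrassCurve ℚ) [W'.IsElliptic] [W'.IsGloballyMinimal] (p' : ℕ)
      [Fact p'.Prime], CellB W' p' → ¬ W'.HasSplitMultiplicativeReductionAtPrime p' →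
        MazurMainConjectureAt W' p' :=
    fun W' _ _ p' _ hB hns' ↦
      mazurMainConjectureAt_of_higherWeightCongruences_of_not_split W' p' hWu hB.2.1.1 hB.2.1.2.2
        hns' hB.2.1.2.1 (hK W' p' hB hns')
  rcases cellA_or_cellB_or_cellC W p hr hX with hA | hB | hC
  · exact targetA_of_published hGV hWu hJs hJn hHs hHn hGZK hmod' hpar hGS W p hA
  · exact bsdp_of_mazurMainConjectureAt_of_analyticRank_eq_zero hJs hJn hHs hHn hGZK hmod' hpar W p
      (hGS W p) hB.2.1.1 hB.2.1.2.2 hB.1 (hMCns W p hB hns)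
  · exact targetC_nonsplit_of_rankOneDisplay_of_mazurMainConjectureAt_nonsplit hGV hWu hJs hJn hHs hHn
      hGZK hpar hGS hmod hHL hGZ hdisp hMCns W p hC hns

end Summit.BirchSwinnertonDyer.Rank1Residual.X2

end
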